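import Summits.AnomalousDissipation.AnomalousDissipation.Theorems.SoloBlindDriftStates

/-!
# Drift screening: steady drifted states, energy, dissipation, work (solo soloist, blind mode)

`SoloBlindDriftScreening` — continuation of `SoloBlindDriftStates`. For the Kolmogorov force
`f = cos(2πx₃) e₁` (`kolForce`) and the drifted states `U_{ν,c}` (`driftState`):

* `isSteadyNSState_driftState`: `U_{ν,c}` is a smooth steady solution of the Navier–Stokes system
  with viscosity `ν` forced by `f` (constant pressure) whenever `(ν, c) ≠ (0, 0)` — the nonlinearity
  is pure advection by the drift, `(U·∇)U = c ∂₃U` (`convect_driftState`), and `c∂₃ - νΔ` acts on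
  the modes `±e₃` as the drift symbol `σ_{ν,c} = 4π²ν ± 2πic` (`driftCoeff_balance`); at `ν = 0`,
  `c ≠ 0` it is a smooth steady forced EULER flow;
* `integral_norm_sq_driftState`, `dissipation_driftState`, `integral_inner_kolForce_driftState`,
  `integral_driftState`: energy `c² + ½/(16π⁴ν² + 4π²c²)`, dissipation = work of the force
  `= 4π²ν · ½/(16π⁴ν² + 4π²c²)`, momentum `c e₃`; the Euler state does no work
  (`integral_inner_kolForce_driftState_zero`);
* `exists_boundedEnergy_vanishingDissipation`: with `c = 1`, `νⱼ = 1/(j+1)` this is a family of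
  global Leray–Hopf solutions for a FIXED smooth divergence-free mean-zero non-zero force with mean
  energy `≤ 2` uniformly in `j` and mean dissipation `≤ νⱼ/2 → 0` — every clause of
  `Literature.Turb.ZerothLaw` except the dissipation floor, which therefore cannot follow from the
  other clauses, and any floor mechanism must control the (free) momentum `∫u`.
[cite: Frisch1995, §5.2] [cite: DoeringFoias2002, §2]
-/

open MeasureTheory Filter Topology Set UnitAddTorus
open scoped ENNReal NNReal ComplexConjugate InnerProductSpace

noncomputable section

namespace Summit.AnomalousDissipation.AnomalousDissipation.Theorems

open Literature.Analysis.FunctionSpaces Literature.Analysis.FunctionSpaces.Torus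
open Literature.Analysis.FluidPDE

/-! ### Derivatives and the steady-state property -/

/-- Drifted states do not depend on `x₁`. [folklore] -/
theorem partialDeriv_zero_driftState (ν c : ℝ) (y : UnitAddTorus (Fin 3)) :
    partialDeriv 0 (driftState ν c) y = 0 := by
  rw [driftState, partialDeriv_realTrigPoly,
    realTrigPoly_congr (c' := 0) fun k hk => by
      rw [apply_zero_of_mem_kolModes₀ hk, Int.cast_zero, mul_zero, zero_smul, Pi.zero_apply],
    realTrigPoly_zero, Pi.zero_apply]

/-- Drifted states do not depend on `x₂`. [folklore] -/
theorem partialDeriv_one_driftState (ν c : ℝ) (y : UnitAddTorus (Fin 3)) :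
    partialDeriv 1 (driftState ν c) y = 0 := by
  rw [driftState, partialDeriv_realTrigPoly,
    realTrigPoly_congr (c' := 0) fun k hk => by
      rw [apply_one_of_mem_kolModes₀ hk, Int.cast_zero, mul_zero, zero_smul, Pi.zero_apply],
    realTrigPoly_zero, Pi.zero_apply]

/-- `∂₃ U_{ν,c}` as a trigonometric polynomial. [folklore] -/
theorem partialDeriv_two_driftState (ν c : ℝ) (y : UnitAddTorus (Fin 3)) :
    partialDeriv 2 (driftState ν c) y = realTrigPoly kolModes₀ (dzCoeff ν c) y := by
  rw [driftState, partialDeriv_realTrigPoly]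
  rfl

/-- The third component of a drifted state is the constant drift `c`. [folklore] -/
theorem driftState_apply_two (ν c : ℝ) (y : UnitAddTorus (Fin 3)) : driftState ν c y 2 = c := by
  rw [driftState, realTrigPoly_apply_coord, trigPoly_apply_coord, kolModes₀,
    Finset.sum_insert zero_not_mem_kolModes, sum_kolModes,
    driftCoeff_apply_two_of_ne_zero ν c (ne_zero_of_mem_kolModes kolFreq_mem),
    driftCoeff_apply_two_of_ne_zero ν c (ne_zero_of_mem_kolModes neg_kolFreq_mem),
    driftCoeff_zero_apply, mFourier_zero]
  simp

/-- **The nonlinearity of a drifted state is pure advection by the drift**: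
`(U·∇)U = c ∂₃U`. [folklore] -/
theorem convect_driftState (ν c : ℝ) (y : UnitAddTorus (Fin 3)) :
    Torus.convect (driftState ν c) (driftState ν c) y =
      c • realTrigPoly kolModes₀ (dzCoeff ν c) y := by
  have h1 : IsContDiff 1 (driftState ν c) := (isSmooth_driftState ν c).isContDiff (by simp)
  rw [Torus.convect, fderiv_apply_eq_sum_partialDeriv h1, Fin.sum_univ_three,
    partialDeriv_zero_driftState, partialDeriv_one_driftState, smul_zero, smul_zero, zero_add,
    zero_add,
    driftState_apply_two, partialDeriv_two_driftState]

/-- `Δ U_{ν,c}` as a trigonometric polynomial. [folklore] -/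
theorem laplacian_driftState (ν c : ℝ) (y : UnitAddTorus (Fin 3)) :
    Torus.laplacian (driftState ν c) y = realTrigPoly kolModes₀ (lapCoeff ν c) y :=
  laplacian_realTrigPoly _ _ y

/-- Real scalars move inside a real trigonometric polynomial (pointwise). [folklore] -/
theorem smul_realTrigPoly_apply (S : Finset (Fin 3 → ℤ)) (r : ℝ)
    (C : (Fin 3 → ℤ) → EuclideanSpace ℂ (Fin 3)) (x : UnitAddTorus (Fin 3)) :
    r • realTrigPoly S C x = realTrigPoly S (r • C) x := by
  rw [realTrigPoly_smul]
  rfl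

/-- **The coefficient balance** `c ∂₃U = νΔU + f` mode by mode on `{0, ±e₃}`:
`(4π²ν + 2πi c k₃) a(k) = f̂(k)`. [folklore] -/
theorem driftCoeff_balance {ν c : ℝ} (h : ν ≠ 0 ∨ c ≠ 0) :
    ∀ k ∈ kolModes₀, c • dzCoeff ν c k = ν • lapCoeff ν c k + kolForceCoeff k := by
  intro k hk
  rcases Finset.mem_insert.1 hk with rfl | hk
  · simp [dzCoeff, lapCoeff, freqNormSq_zero, kolForceCoeff_zero]
  · have hk0 := ne_zero_of_mem_kolModes hk
    have hσ : driftSymbol ν c k ≠ 0 := driftSymbol_ne_zero h hk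
    have hinv : driftSymbol ν c k * (driftSymbol ν c k)⁻¹ = 1 := mul_inv_cancel₀ hσ
    have hdef := driftSymbol_eq ν c k
    rw [dzCoeff, lapCoeff, driftCoeff_of_ne_zero ν c hk0, kolForceCoeff_of_ne_zero hk0,
      freqNormSq_of_mem_kolModes hk, ← Complex.coe_smul, ← Complex.coe_smul, smul_smul, smul_smul,
      smul_neg, smul_smul, ← neg_smul, smul_smul,
      show ∀ z : ℂ, z • kolVec + kolVec = (z + 1) • kolVec from fun z => by rw [add_smul, one_smul]]
    congr 1
    push_cast at hdef ⊢
    linear_combination (-(driftSymbol ν c k)⁻¹) * hdef + hinv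

/-- **Drifted Kolmogorov states are steady Navier–Stokes states** forced by the Kolmogorov force,
with constant pressure: `(U·∇)U = νΔU - ∇0 + f`, `div U = 0` — for every viscosity `ν` and drift
`c` not both zero; at `ν = 0`, `c ≠ 0` this is a smooth steady solution of the forced EULER system
(`U_{0,c} = c e₃ + sin(2πx₃) e₁ / (2πc)`). [folklore] -/
theorem isSteadyNSState_driftState {ν c : ℝ} (h : ν ≠ 0 ∨ c ≠ 0) :
    Torus.IsSteadyNSState ν kolForce (driftState ν c) (fun _ => 0) := by
  refine ⟨isSmoothSpaceTimeOn_const (isSmooth_driftState ν c) _,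
    isSmoothSpaceTimeOn_const (isSmooth_const (0 : ℝ)) _, fun t _ y => ?_,
    fun _ _ => isDivFree_driftState ν c⟩
  have ht : Torus.timeDerivWithin Set.univ (fun _ : ℝ => driftState ν c) t y = 0 := by
    simp [Torus.timeDerivWithin]
  have hg : Torus.gradient (fun _ : UnitAddTorus (Fin 3) => (0 : ℝ)) y = 0 := by
    unfold Torus.gradient Torus.liftAt
    simp [_root_.gradient]
  rw [ht, zero_add, hg, sub_zero, convect_driftState, laplacian_driftState, kolForce_apply_eq,
    smul_realTrigPoly_apply, smul_realTrigPoly_apply]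
  have hfun : realTrigPoly kolModes₀ (c • dzCoeff ν c) =
      realTrigPoly kolModes₀ (ν • lapCoeff ν c + kolForceCoeff) :=
    realTrigPoly_congr fun k hk => by
      simpa only [Pi.smul_apply, Pi.add_apply] using driftCoeff_balance h k hk
  rw [hfun, realTrigPoly_add]
  rfl

/-! ### Energy, dissipation, momentum -/

/-- **Energy of a drifted state**: `∫‖U_{ν,c}‖² = c² + ½ / (16π⁴ν² + 4π²c²)` — bounded uniformly
in `ν` for every fixed drift `c ≠ 0`. [folklore] -/
theorem integral_norm_sq_driftState (ν c : ℝ) :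
    ∫ x, ‖driftState ν c x‖ ^ 2 =
      c ^ 2 + (1 / 2) / ((4 * Real.pi ^ 2 * ν) ^ 2 + (2 * Real.pi * c) ^ 2) := by
  rw [driftState, integral_norm_sq_realTrigPoly kolModes₀_symm (isConjSymm_driftCoeff ν c),
    kolModes₀,
    Finset.sum_insert zero_not_mem_kolModes, sum_kolModes,
    norm_sq_driftCoeff ν c kolFreq_mem, norm_sq_driftCoeff ν c neg_kolFreq_mem, driftCoeff_zero,
    EuclideanSpace.norm_complexify, PiLp.norm_single, Real.norm_eq_abs, sq_abs]
  ring

/-- **Dissipation of a drifted state**: `ν‖∇U_{ν,c}‖₂² = 4π²ν · ½ / (16π⁴ν² + 4π²c²)`. [folklore] -/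
theorem dissipation_driftState (ν c : ℝ) :
    ν * (eGradNormSq (driftState ν c)).toReal =
      4 * Real.pi ^ 2 * ν * ((1 / 2) / ((4 * Real.pi ^ 2 * ν) ^ 2 + (2 * Real.pi * c) ^ 2)) := by
  rw [driftState, toReal_eGradNormSq_realTrigPoly kolModes₀_symm (isConjSymm_driftCoeff ν c),
    kolModes₀,
    Finset.sum_insert zero_not_mem_kolModes, sum_kolModes, freqNormSq_zero,
    zero_mul, zero_add, freqNormSq_of_mem_kolModes kolFreq_mem,
    freqNormSq_of_mem_kolModes neg_kolFreq_mem,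
    one_mul, one_mul, norm_sq_driftCoeff ν c kolFreq_mem, norm_sq_driftCoeff ν c neg_kolFreq_mem]
  ring

/-- `⟪v, v⟫_ℂ = 1/4` for the Kolmogorov coefficient vector. [folklore] -/
theorem inner_kolVec_self : inner ℂ kolVec kolVec = ((1 / 4 : ℝ) : ℂ) := by
  simp only [PiLp.inner_apply, Fin.sum_univ_three, kolVec_apply_zero, kolVec_apply_one,
    kolVec_apply_two, RCLike.inner_apply, Complex.conj_ofReal]
  push_cast
  norm_num

/-- Mode-by-mode work of the force on a drifted state: `Re ⟪f̂(k), a(k)⟫ = π²ν / (16π⁴ν² + 4π²c²)`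
on `±e₃`. [folklore] -/
theorem re_inner_kolForceCoeff_driftCoeff (ν c : ℝ) {k : Fin 3 → ℤ} (hk : k ∈ kolModes) :
    (inner ℂ (kolForceCoeff k) (driftCoeff ν c k)).re =
      Real.pi ^ 2 * ν / ((4 * Real.pi ^ 2 * ν) ^ 2 + (2 * Real.pi * c) ^ 2) := by
  have hk0 := ne_zero_of_mem_kolModes hk
  rw [kolForceCoeff_of_ne_zero hk0, driftCoeff_of_ne_zero ν c hk0, inner_smul_right,
    inner_kolVec_self, Complex.re_mul_ofReal]
  have hnormSq : Complex.normSq (driftSymbol ν c k) =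
      (4 * Real.pi ^ 2 * ν) ^ 2 + (2 * Real.pi * c) ^ 2 := by
    rw [← Complex.sq_norm, norm_sq_driftSymbol ν c hk]
  rw [Complex.inv_re, hnormSq, driftSymbol_re]
  ring

/-- **Work of the force on a drifted state**: `∫⟪f, U_{ν,c}⟫ = 4π²ν · ½ / (16π⁴ν² + 4π²c²)` — equal
to the dissipation (steady energy balance), and `→ 0` as `ν → 0` at fixed drift: the drift detunes
the force–flow resonance. [folklore] -/
theorem integral_inner_kolForce_driftState (ν c : ℝ) :
    ∫ x, ⟪kolForce x, driftState ν c x⟫_ℝ =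
      4 * Real.pi ^ 2 * ν * ((1 / 2) / ((4 * Real.pi ^ 2 * ν) ^ 2 + (2 * Real.pi * c) ^ 2)) := by
  have hf : kolForce = realTrigPoly kolModes₀ kolForceCoeff := funext kolForce_apply_eq
  rw [hf, driftState, integral_inner_realTrigPoly_realTrigPoly kolModes₀_symm
    isConjSymm_kolForceCoeff (isConjSymm_driftCoeff ν c), kolModes₀,
    Finset.sum_insert zero_not_mem_kolModes, kolForceCoeff_zero,
    inner_zero_left, Complex.zero_re, zero_add, sum_kolModes,
    re_inner_kolForceCoeff_driftCoeff ν c kolFreq_mem,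
    re_inner_kolForceCoeff_driftCoeff ν c neg_kolFreq_mem]
  ring

/-- **The drifted Euler states do no work against the force**: `∫⟪f, U_{0,c}⟫ = 0` — a smooth
steady forced Euler flow (`isSteadyNSState_driftState` with `ν = 0`) in exact balance with a
non-zero force and zero energy input (complete screening by sweeping). [folklore] -/
theorem integral_inner_kolForce_driftState_zero (c : ℝ) :
    ∫ x, ⟪kolForce x, driftState 0 c x⟫_ℝ = 0 := by
  rw [integral_inner_kolForce_driftState]
  ring

/-- **Momentum of a drifted state**: `∫ U_{ν,c} = c e₃`. [folklore] -/
theorem integral_driftState (ν c : ℝ) :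
    ∫ x, driftState ν c x = (EuclideanSpace.single 2 c : EuclideanSpace ℝ (Fin 3)) := by
  rw [driftState]
  simp_rw [realTrigPoly_apply_eq_sum]
  have hI : ∀ k,
      Integrable (fun x : UnitAddTorus (Fin 3) => mFourier k x • driftCoeff ν c k) volume :=
    fun k => ((mFourier k).continuous.smul continuous_const).integrable_unitAddTorus
  have hint : ∀ k ∈ kolModes₀,
      Integrable (fun x : UnitAddTorus (Fin 3) =>
        EuclideanSpace.realPart (mFourier k x • driftCoeff ν c k)) volume :=
    fun k _ => (EuclideanSpace.realPart :
      EuclideanSpace ℂ (Fin 3) →L[ℝ] EuclideanSpace ℝ (Fin 3)).integrable_comp (hI k)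
  rw [integral_finsetSum _ hint, kolModes₀, Finset.sum_insert zero_not_mem_kolModes,
    Finset.sum_eq_zero fun k hk => ?_, add_zero]
  · rw [(EuclideanSpace.realPart :
        EuclideanSpace ℂ (Fin 3) →L[ℝ] EuclideanSpace ℝ (Fin 3)).integral_comp_comm (hI 0),
      integral_smul_const, integral_mFourier, if_pos rfl, one_smul, driftCoeff_zero,
      EuclideanSpace.realPart_complexify]
  · rw [(EuclideanSpace.realPart :
        EuclideanSpace ℂ (Fin 3) →L[ℝ] EuclideanSpace ℝ (Fin 3)).integral_comp_comm (hI k),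
      integral_smul_const, integral_mFourier, if_neg (ne_zero_of_mem_kolModes hk), zero_smul,
      map_zero]

/-- Drifted states with `c ≠ 0` carry momentum: they are NOT mean-zero. [folklore] -/
theorem not_hasZeroMean_driftState (ν : ℝ) {c : ℝ} (hc : c ≠ 0) :
    ¬ HasZeroMean (driftState ν c) := by
  intro h
  have h' : (EuclideanSpace.single 2 c : EuclideanSpace ℝ (Fin 3)) = 0 := by
    rw [← integral_driftState ν c]; exact h
  have := congrArg (fun v : EuclideanSpace ℝ (Fin 3) => v 2) h'
  simp at this
  exact hc this

/-- Energy bound at unit drift: `∫‖U_{ν,1}‖² ≤ 2`, uniformly in `ν`. [folklore] -/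
theorem integral_norm_sq_driftState_one_le (ν : ℝ) : ∫ x, ‖driftState ν 1 x‖ ^ 2 ≤ 2 := by
  rw [integral_norm_sq_driftState ν 1]
  have hπ := Real.pi_gt_three
  have hD : (1 : ℝ) / 2 ≤ (4 * Real.pi ^ 2 * ν) ^ 2 + (2 * Real.pi * 1) ^ 2 := by
    nlinarith [sq_nonneg (4 * Real.pi ^ 2 * ν)]
  have hD' : (1 / 2 : ℝ) / ((4 * Real.pi ^ 2 * ν) ^ 2 + (2 * Real.pi * 1) ^ 2) ≤ 1 :=
    (div_le_one (by positivity)).2 hD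
  linarith

/-- Dissipation bound at unit drift: `ν‖∇U_{ν,1}‖₂² ≤ ν/2`. [folklore] -/
theorem dissipation_driftState_one_le {ν : ℝ} (hν : 0 < ν) :
    ν * (eGradNormSq (driftState ν 1)).toReal ≤ ν / 2 := by
  rw [dissipation_driftState ν 1]
  have hπ := Real.pi_gt_three
  have hD : 0 < (4 * Real.pi ^ 2 * ν) ^ 2 + (2 * Real.pi * 1) ^ 2 := by positivity
  rw [mul_div_assoc', div_le_iff₀ hD]
  nlinarith [sq_nonneg (4 * Real.pi ^ 2 * ν), mul_pos hν (by positivity : (0 : ℝ) < Real.pi ^ 2)]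

/-! ### Leray–Hopf packaging and the separating family -/

/-- A drifted state is a global Leray–Hopf solution of `NS_ν(f)` from its own value
(Robinson–Rodrigo–Sadowski 2016, Thm. 6.5, via the tree's
`IsClassicalNSSolutionOn.isGlobalLerayHopf`).
[cite: RobinsonRodrigoSadowski2016, Thm. 6.5] -/
theorem isGlobalLerayHopf_driftState {ν c : ℝ} (h : ν ≠ 0 ∨ c ≠ 0) :
    Torus.IsGlobalLerayHopf ν (fun _ => kolForce) (driftState ν c) (fun _ => driftState ν c) :=
  IsClassicalNSSolutionOn.isGlobalLerayHopf (isSteadyNSState_driftState h)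

/-- The mean energy of the time-independent drifted flow is its energy. [folklore] -/
theorem meanEnergy_driftState (ν c : ℝ) :
    meanEnergy (fun _ : ℝ => driftState ν c) = ∫ x, ‖driftState ν c x‖ ^ 2 := by
  rw [meanEnergy_eq_longTimeAvgSup]
  exact longTimeAvgSup_of_eq_const fun _ _ => rfl

/-- The mean dissipation of the time-independent drifted flow is `ν‖∇U‖₂²`. [folklore] -/
theorem meanDissipation_driftState (ν c : ℝ) :
    meanDissipation ν (fun _ : ℝ => driftState ν c) =
      ν * (eGradNormSq (driftState ν c)).toReal := by
  unfold meanDissipation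
  exact longTimeAvgSup_of_eq_const fun _ _ => rfl

/-- **Bounded energy does not force anomalous dissipation (drift screening).** For the fixed
Kolmogorov force `f = cos(2πx₃) e₁ ≠ 0` (smooth, divergence free, mean zero) and `νⱼ = 1/(j+1) → 0`
there are global Leray–Hopf solutions of `NS_{νⱼ}(f)` — the drifted steady states `U_{νⱼ,1}` —
whose mean energies are bounded by `2` uniformly in `j` while their mean energy dissipation rates
are `≤ νⱼ/2` and tend to `0`; each carries the momentum `∫U = e₃`. Every clause of
`Literature.Turb.ZerothLaw` except the dissipation floor holds along this family. [folklore] -/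
theorem exists_boundedEnergy_vanishingDissipation :
    ∃ f : UnitAddTorus (Fin 3) → EuclideanSpace ℝ (Fin 3),
      IsSmooth f ∧ IsDivFree f ∧ HasZeroMean f ∧ f ≠ 0 ∧
      ∃ (ν : ℕ → ℝ) (u₀ : ℕ → UnitAddTorus (Fin 3) → EuclideanSpace ℝ (Fin 3))
        (u : ℕ → ℝ → UnitAddTorus (Fin 3) → EuclideanSpace ℝ (Fin 3)),
        (∀ j, 0 < ν j) ∧ Tendsto ν atTop (𝓝 0) ∧
        (∀ j, Torus.IsGlobalLerayHopf (ν j) (fun _ => f) (u₀ j) (u j)) ∧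
        (∀ j, meanEnergy (u j) ≤ 2) ∧
        (∀ j, meanDissipation (ν j) (u j) ≤ ν j / 2) ∧
        Tendsto (fun j => meanDissipation (ν j) (u j)) atTop (𝓝 0) ∧
        (∀ j t, ∫ x, u j t x = (EuclideanSpace.single 2 (1 : ℝ) : EuclideanSpace ℝ (Fin 3))) := by
  have hν : ∀ j : ℕ, (0 : ℝ) < 1 / ((j : ℝ) + 1) := fun j => by positivity
  refine ⟨kolForce, isSmooth_kolForce, isDivFree_kolForce, hasZeroMean_kolForce, kolForce_ne_zero,
    fun j => 1 / ((j : ℝ) + 1), fun j => driftState (1 / ((j : ℝ) + 1)) 1,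
    fun j _ => driftState (1 / ((j : ℝ) + 1)) 1, hν, tendsto_one_div_add_atTop_nhds_zero_nat,
    fun j => isGlobalLerayHopf_driftState (Or.inl (hν j).ne'), fun j => ?_, fun j => ?_, ?_,
    fun j _ => integral_driftState _ 1⟩
  · rw [meanEnergy_driftState]
    exact integral_norm_sq_driftState_one_le _
  · rw [meanDissipation_driftState]
    exact dissipation_driftState_one_le (hν j)
  · refine squeeze_zero (fun j => ?_) (fun j => ?_)
      ((tendsto_one_div_add_atTop_nhds_zero_nat.div_const 2).trans_eq (by simp))
    · rw [meanDissipation_driftState]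
      exact mul_nonneg (hν j).le ENNReal.toReal_nonneg
    · rw [meanDissipation_driftState]
      exact dissipation_driftState_one_le (hν j)

end Summit.AnomalousDissipation.AnomalousDissipation.Theorems

end
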